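import Mathlib
import HarnessLib
import Literature.NumberTheory.LFunctions.ZeroCountingLevinsonProofs
import Literature.NumberTheory.LFunctions.AlternativeHypothesisConsequences
import Literature.NumberTheory.LFunctions.CharZeroSum
import Literature.NumberTheory.LFunctions.XiDerivativeZeros

/-!
# RH-FREE — «nothing here bears on the truth of RH»: two thirds of the zeros of `ζ` simple and on the critical line, five sixths distinct, unconditionally (Alpöge–Furman 2026, arXiv:2608.13637: Theorems A, B; Lemma 3.2; Lemma 5.6; Remarks 6.1, 7.1), typed AS PRINTED as claims of an unrefereed preprint

Topic `Literature/NumberTheory/LFunctions` (namespace `Literature.NumberTheory.LFunctions`; the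
Dirichlet-`L` window counts in the sub-namespace `AlpogeFurman2026`). STATEMENT LAYER (D-0014),
cell `rh-columns/lit`, tranche 1: the principal results of

* **[AF26]** L. Alpöge, R. Furman, *More than two thirds of the zeros of the Riemann zeta function
  are simple and on the critical line*, arXiv:2608.13637v2 (19 Aug 2026), 21 pp. UNREFEREED
  (D-0012: every statement below that the source proves is a `[claim: …, status: under-review]`,
  consumed as a hypothesis `(h : AlpogeFurman2026_…)`, never asserted). Held: TeX v2 of record
  (`run/shared/lean/pub/rh-crit/ah/src/AlpogeFurman2026_arXiv2608.13637v2.tex`) and PDF text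
  (`paper:arxiv-2608.13637`). Title footnote: "The mathematical argument in this paper was
  discovered and written by Claude, an AI developed by Anthropic. The listed authors verified the
  proof and take responsibility for its content." A Lean 4 formalisation of Theorems A and B
  (repository `github.com/anthropics/zeta-23-lean`, tag `v1.0`, toolchain v4.33.0-rc2) is described in
  Appendix A (p. 15); its top-level statements are reproduced in the docstrings below for comparison.
  This file records STATEMENTS; it endorses nothing and re-proves nothing of [AF26].

## What the source prints (locators = PDF pages of v2)

* §1.1 (p. 1): `N(T₁,T₂) := Σ_{T₁<γ≤T₂} m_ρ` (zeros with multiplicity), `N_d(T₁,T₂) := #{ρ : T₁<γ≤T₂}`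
  (distinct zeros), `N₀^*(T₁,T₂) := #{ρ : T₁<γ≤T₂, β = ½}` (distinct zeros on the line),
  `N₀^s(T₁,T₂) := #{ρ : T₁<γ≤T₂, β = ½, m_ρ = 1}` (simple zeros on the line); `N₀` = on-line with
  multiplicity, `N^s` = simple zeros anywhere.
* **Theorem A** (p. 1). "As `T → ∞`, (i) `N₀^s(T,2T) ≥ (2/3 − o(1)) N(T,2T)`, (ii)
  `N_d(T,2T) ≥ (5/6 − o(1)) N(T,2T)`. With the Montgomery–Taylor window `ψ_MT` of (2.7) in place of
  the indicator window `ψ₀`, the constants improve to `2 − c_MT⁻¹ = 0.67250…` and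
  `½(3 − c_MT⁻¹) = 0.83625…` respectively, where `c_MT⁻¹ := ½ + (1/√2) cot(1/√2)` … A fortiori
  `N₀^*(T,2T), N₀(T,2T), N^s(T,2T) ≥ (2/3 − o(1)) N(T,2T)`." After the theorem (p. 2): "The same holds
  for `(0,T)` in place of `(T,2T)`, with rate `O(log log T/ log T)` (Remark 6.1)."
* **Theorem B** (p. 2). "Theorem A holds verbatim for `L(s,χ)` in place of `ζ(s)`, for any fixed
  primitive Dirichlet character `χ`."
* **Lemma 3.2** (Rank–trace inequality, p. 5). "Let `P, Q` be Hermitian `d × d` matrices with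
  `P ⪰ 0`, `rank P ≤ r`, and `n₊(Q) ≤ b`. Then `r ≥ 2 tr P + 4 tr Q − 4b − ‖P + Q‖²_HS`."
  (`n₊(R)` = number of strictly positive eigenvalues, `‖R‖²_HS = tr R²`, §1.7.) Proof printed in
  full (von Neumann's trace inequality); Remark 3.3 gives a second proof.
* **Lemma 5.6** (Window constant, p. 11). For even `ψ ∈ C([−½,½])`, `ψ > 0`,
  `R(ψ) := (∫_{−½}^{½} ψ² + ∫∫_{[−½,½]²} |u − v| ψ(u)ψ(v) du dv)/(∫_{−½}^{½} ψ)²` (5.10); then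
  `R(ψ₀) = 4/3` and `R(ψ_MT) = ½ + (1/√2) cot(1/√2) = c_MT⁻¹`, `ψ_MT(s) = cos(√2 s) 1_{[−½,½]}(s)` (2.7).
  The theorem's constants are `2 − R(ψ)` and `½(3 − R(ψ))` (chain (1.2), §6).
* **Remark 6.1** (p. 12). "Tracking errors gives `N₀^s(T,2T) ≥ (2 − R(ψ) − c_ψ log log T/ log T) N(T,2T)`
  for `T ≥ T₀(ψ,χ)`."
* **Remark 7.1** (p. 14). Applied to `ξ′`: unconditionally
  `liminf N^s_{0,ξ′}(T,2T)/N_{ξ′}(T,2T) ≥ 0.85838` and `liminf N_{d,ξ′}(T,2T)/N_{ξ′}(T,2T) ≥ 0.92919`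
  (flat window), `N_{ξ′}` counting zeros of `ξ′` with `T₁ < γ₁ ≤ T₂` with multiplicity, `N^s_{0,ξ′}`
  the simple ones with `β₁ = ½`; "formalised in Lean at the cited tag as
  `Zeta23.XiPrime.xiDeriv_simple_on_line`".
* Appendix A (p. 15), the repository's statements (no hypotheses), e.g.
  `theorem thmB₀_mult : ∀ ε > 0, ∃ T₀ : ℝ, ∀ T ≥ T₀, (2/3 - ε) * (Ncount T (2*T) : ℝ) ≤ N0simple T (2*T)`,
  `thmC₀_mult : … (5/6 - ε) * (Ncount T (2*T) : ℝ) ≤ Ndist T (2*T)`, the `_cumulative` versions with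
  `Ncount 0 T`, `N0simple 0 T`, `Ndist 0 T`, and `montgomery_taylor_simple_on_critical_line_mult :
  … (2 - 1/cMT - ε) * Ncount T (2*T) ≤ N0simple T (2*T)`, `cMT := √2·tan(1/√2)/(1 + (1/√2)·tan(1/√2))`,
  over `Ncount T₁ T₂ := ∑ᶠ ρ ∈ zerosIn T₁ T₂, zeroMult ρ`, `zerosIn T₁ T₂ := {ρ | IsNontrivialZero ρ ∧
  T₁ < ρ.im ∧ ρ.im ≤ T₂}`, `zeroMult ρ := (analyticOrderAt riemannZeta ρ).toNat`, `Ndist = ncard`,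
  `N0simple = ncard (… ∩ {re = ½} ∩ {zeroMult = 1})`.

## Lean rendering (tree vocabulary; nothing about zeros is re-declared)

* `ζ`: the tree's cumulative counts of `ZetaZeros.lean` / `SimpleZeros.lean` over the boxes
  `zetaZeroBox σ T` (`0 < Im ρ ≤ T`): `N(T) = zetaZeroCount T`, `N₀(T) = criticalZeroCount T`,
  `N₀^s(T) = simpleCriticalZeroCount T` (= Titchmarsh's `N⁽¹⁾`), `N^s(T) = simpleZeroCount T`,
  `N_d(T) = distinctZeroCount T`, multiplicity `m(ρ) = riemannZetaZeroOrder ρ`. A dyadic count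
  `X(T,2T)` is written as the real difference `X(2T) − X(T)` of cumulative counts (exact for `T ≥ 0`:
  the boxes are nested and the counts additive); the repository's `zerosIn`/`Ncount` differ from the
  tree's boxes only by the closed conditions `0 ≤ Re ρ ≤ 1` (no zeros on `Re ρ ∈ {0,1}`) and by the
  order read through `meromorphicOrderAt` instead of `analyticOrderAt` (equal off `ρ = 1`).
* "`A ≥ (c − o(1)) B` as `T → ∞`" is spelled `∀ ε > 0, ∀ᶠ T in atTop, (c − ε) B(T) ≤ A(T)`, the
  spelling of `SimpleZeros.lean` (`Montgomery1973_simple_zeros`); it is the repository's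
  `∀ ε > 0, ∃ T₀, ∀ T ≥ T₀, …` by `Filter.eventually_atTop`.
* `L(s,χ)` (Theorem B): zeros `ExplicitPsiChar.charNontrivialZeros χ` and multiplicities
  `DirichletDisc.zeroOrder χ ρ` of `CharZeroSum.lean` (as in `CriticalZerosDirichletFamilySono.lean`);
  primitivity is Mathlib's `DirichletCharacter.IsPrimitive`; the window counts `T₁ < Im ρ ≤ T₂` are
  the three small definitions of `namespace AlpogeFurman2026` below (finite sets; `finsum`/`ncard`).
* `ξ′` (Remark 7.1): `xiDerivZeroBox 1 T`, `xiDerivZeroCount 1 T` of `XiDerivativeZeros.lean`.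
* Lemma 3.2: complex `d × d` matrices, `P.PosSemidef`, `Q.IsHermitian`, `Matrix.rank`, the number
  `posEigenvalueCount hQ` of indices `i` with `0 < hQ.eigenvalues i` (Mathlib has no inertia index;
  this 1-line definition is the printed `n₊`), traces read through `Complex.re` (real for Hermitian
  matrices), `‖P + Q‖²_HS = Re tr (P+Q)²`.
* Lemma 5.6: `windowConstant ψ = R(ψ)` over interval integrals on `[−½,½]` (the window enters only
  through its values there); `R(ψ₀) = 4/3` is PROVED (`windowConstant_one`); `R(ψ_MT)` is a claim.

## Proved here (cheap kernel consequences)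

`AlpogeFurman2026_simple_critical.critical` / `.simple` / `.third` (the "a fortiori" sentence of
Theorem A in cumulative form, and Titchmarsh's "at least a third" conclusion; the count comparisons
`simpleCriticalZeroCount_le_criticalZeroCount`, `GLSS2026.simpleCriticalZeroCount_le_simpleZeroCount`
are the tree's, `ZeroCountingLevinsonProofs.lean` / `AlternativeHypothesisConsequences.lean`);
`Montgomery1973_simple_zeros_of_AlpogeFurman2026`, `Montgomery1973_distinct_zeros_of_AlpogeFurman2026`
(the RH-conditional named facts of `SimpleZeros.lean` follow from the unconditional claims);
`windowConstant_one` (`R(ψ₀) = 4/3`, whence the constants `2 − 4/3 = 2/3`, `½(3 − 4/3) = 5/6`: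
`AlpogeFurman2026_constants`).

## Proved elsewhere in this tree (cross-references as of 2026-08-27; all RH-FREE, axioms standard)

Every LEMMA of [AF26] and the finite-dimensional skeleton of §§3, 4.1, 6 are kernel theorems in
sibling files (this statement file is unchanged by them; the claims below stay claims):
* Lemma 3.2 — `AlpogeFurman2026_rank_trace_holds`; Lemma 5.6 — `AlpogeFurman2026_windowConstant_MT_holds`
  (`R(ψ_MT) = c_MT⁻¹`); "summing over dyadic windows" (§6) — `AlpogeFurman2026_simple_critical_of_dyadic`,
  `AlpogeFurman2026_distinct_of_dyadic` (`CriticalLineTwoThirdsProofs.lean`);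
* Lemma 3.1 (inertia under pull-back, both directions of Sylvester's law for `n₊`), Proposition 4.1's
  block structure at matrix level, Corollary 4.4's certificate `AlpogeFurman2026_block_certificate`
  (`CriticalLineTwoThirdsInertia.lean`, cell `landau-siegel`);
* Lemma 2.2 (Montgomery–Vaughan bilinear form) with (2.9), Lemma 3.3 (Weyl) —
  `AlpogeFurman2026_MV_bilinear{,_of_sep,_log}`, `AlpogeFurman2026_weyl{,_opNorm}`
  (`CriticalLineTwoThirdsSpectralInputs.lean`);
* Lemma 2.1 (Poisson–Gabor identity) — `AlpogeFurman2026_poisson_gabor`, `_poisson_gabor_diag`,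
  `_gabor_truncation` (`GaborCriticalDensityPoisson.lean`);
* Lemma 5.1 eq. (5.5) — `AlpogeFurman2026_sum_vonMangoldt_sq_div{,_mul_log}`
  (`VonMangoldtSqHarmonicMoments.lean`);
* §6, the certificate for simple zeros `(P₁, Q′)` (`n₊(Q′) ≤ s₂ + p`, the displayed inequality and
  its (i)/(ii) rearrangements) — `AlpogeFurman2026_mixed_blocks`, `AlpogeFurman2026_simple_block_certificate`,
  `_simple_chain_i`, `_simple_chain_ii`; the web of implications among the claims of this file
  (`_simple_critical_dyadic_of_MT`, `_distinct_dyadic_of_MT`, `_simple_critical_dyadic_of_rate`, hence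
  the cumulative forms: only `_simple_critical_MT_dyadic`, `_distinct_MT_dyadic`, `_simple_critical_rate`
  are independent among the seven `ζ`-claims); and the p. 2 sentence "(0,T) … with rate
  `O(log log T/log T)`" from Remark 6.1 — `AlpogeFurman2026_simple_critical_rate.cumulative`
  (`CriticalLineTwoThirdsSimpleCertificate.lean`);
* the decimals `0.67250…`, `0.83625…` — `montgomeryTaylorInvConstant_bounds`,
  `AlpogeFurman2026_MT_proportions_bounds` (`MontgomeryTaylorConstantNumerics.lean`);
* `κ ≥ 2/3` in the `liminf` vocabulary of `ZeroCounting.lean`, hence `przz_bound`, `conrey_bound` —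
  `AlpogeFurman2026_simple_critical.two_thirds_le_criticalLineProportion`, `przz_bound_of_AlpogeFurman2026`
  (`CriticalLineTwoThirdsProportion.lean`);
* the follow-up of Hua–Yang, arXiv:2608.16034 (prime-modulus Dirichlet family) is typed in
  `DirichletFamilySimpleZerosMesoscopic.lean`;
* Remark 7.1 (`ξ′`) ⇒ `0.85838 ≤ xiDerivCriticalLineProportion 1` ⇒ the Conrey 1983 named fact
  `conrey1983_xiDeriv_one` (`0.8137`), and its cumulative `(0,T]` form —
  `AlpogeFurman2026_xiDeriv_simple_critical_dyadic.le_xiDerivCriticalLineProportion`,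
  `conrey1983_xiDeriv_one_of_AlpogeFurman2026`, `….cumulative` (`CriticalLineTwoThirdsXiDeriv.lean`,
  over the `ξ′` counting infrastructure of `XiDerivativeZerosCounting.lean`: zeros of `ξ′` in the open
  strip, `xiDerivZeroBox 1 T` finite, `N_{ξ′}(T) → ∞`);
* §§2.2–2.3, the CONCRETE compressed form (ramp `χ := Real.smoothTransition`, test function `φ`,
  `a`, `d`, `γ_ρ`, `v_ρ`, the zeros with `Re γ_ρ ∈ I′`, `N(I′)`, `G̃`, `P`, `Q`, `on₁/on≥2/pairs`, `P₁`:
  `AlpogeFurman2026.phi/zeroVec/nearZeros/gramMatrix/onLineMatrix/offLineMatrix/onSimpleMatrix`, …)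
  and the two analytic evaluations consumed by §6, typed as claims — **Proposition 4.2**
  `AlpogeFurman2026_trace` (`tr G̃ = N(I′) + O(√T L²)`) and **Theorem 5.7**
  `AlpogeFurman2026_hilbertSchmidt` (`‖G̃‖²_HS = (R(ψ) + O(1/L)) N(T,2T)`) —
  `CriticalLineTwoThirdsMatrix.lean`; over them **Proposition 4.1 and Corollary 4.5 (v2 numbering;
  Remark 4.4 precedes it) PROVED** (`onLineMatrix_posSemidef/_rank_le/_trace_re_le`,
  `posEigenvalueCount_offLineMatrix_le`, `AlpogeFurman2026_cor45_trace/_rank`) and **Theorem A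
  ASSEMBLED in the kernel from Proposition 4.2 ∧ Theorem 5.7** for every window
  (`AlpogeFurman2026_thmA_simple_of_trace_HS`, `AlpogeFurman2026_thmA_distinct_of_trace_HS`), whence
  `AlpogeFurman2026_simple_critical_dyadic_of_trace_HS`, `_distinct_dyadic_of_trace_HS`,
  `_simple_critical_MT_dyadic_of_trace_HS`, `_distinct_MT_dyadic_of_trace_HS`,
  `AlpogeFurman2026_thmA_cumulative_of_trace_HS` — `CriticalLineTwoThirdsMatrixProofs.lean`;
* UPDATE (2026-08-27, gens 7–8): the two analytic evaluations are PROVED for the typed model —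
  Proposition 4.2 `AlpogeFurman2026_trace_holds` (`CriticalLineTwoThirdsTraceProofs.lean`, with
  Proposition 4.3 in `CriticalLineTwoThirdsTailProofs.lean`) and Theorem 5.7
  `AlpogeFurman2026_hilbertSchmidt_holds` (`CriticalLineTwoThirdsHilbertSchmidtProofs.lean`, through
  Propositions 5.2–5.5 in `CriticalLineTwoThirdsReduction.lean`, `…ArchProofs.lean`,
  `…PrimeTermProofs.lean`) — so the seven `ζ`-claims of this file are DISCHARGED
  (`AlpogeFurman2026_simple_critical_dyadic_holds`, `_distinct_dyadic_holds`, `_simple_critical_holds`,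
  `_distinct_holds`, `_simple_critical_MT_dyadic_holds`, `_distinct_MT_dyadic_holds`,
  `_simple_critical_rate_holds`, with `two_thirds_le_criticalLineProportion`, `przz_bound_holds`,
  `conrey_bound_holds`, `one_third_le_criticalLineProportion_holds`) in
  `CriticalLineTwoThirdsTheoremAProofs.lean` — kernel facts of this tree with the standard axioms, whose
  statements mention only `zetaZeroCount`, `simpleCriticalZeroCount`, `distinctZeroCount`,
  `criticalLineProportion`; no endorsement of the source.
Still claims (not re-established): Theorem B (`AlpogeFurman2026_dirichlet_*`) and Remark 7.1
(`AlpogeFurman2026_xiDeriv_simple_critical_dyadic`).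

## Status note (one paragraph, no endorsement)

[AF26] is an unrefereed arXiv preprint (v1 13 Aug, v2 19 Aug 2026) claiming, unconditionally, the
proportions `2/3` (simple, on the line) and `5/6` (distinct) that Montgomery 1973 / Conrey–Ghosh–Gonek
1998 obtained under RH (tree: `Montgomery1973_simple_zeros`, `Montgomery1973_distinct_zeros`), against
the unconditional records `5/12` (Pratt–Robles–Zaharescu–Zeindler 2020) and `0.6603` (Wu 2015); the
stated inputs are Weil's explicit formula, Riemann–von Mangoldt, Stirling, Chebyshev–Mertens and the
Montgomery–Vaughan inequality (p. 2: "No mollifier, zero-density estimate, or zero-free region is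
used"), the new step being Lemma 3.2 applied to a finite compression of Weil's form (Sylvester
inertia for off-line pairs). The authors state that a sorry-free Lean 4 formalisation with only the
three standard axioms accompanies the paper (Appendix A); this tree has NOT replayed it and typed the
results as claims. UPDATE (2026-08-27): the tree has since formalised, independently and over its own
typed model of §§2.2–2.3 (`CriticalLineTwoThirdsMatrix.lean`), Propositions 4.1–4.3, 5.2–5.5,
Theorem 5.7 and the §6 assembly, so that the seven `ζ`-claims below are kernel theorems of this tree
(`…_holds`, `CriticalLineTwoThirdsTheoremAProofs.lean`, standard axioms); Theorem B and Remark 7.1 stay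
claims. This is a statement about the tree, not an assessment of the preprint. Remark 7.2 (family averages `0.811`/`0.905`) is printed
with "details … omitted" and "not included in the Lean formalisation" and is NOT typed; §7.2's
bandwidth-one ceiling `≈ 0.682` rests on interval enclosures "not checked by the Lean kernel" and is
NOT typed. Nothing here bears on the truth of RH: the theorems are lower bounds insensitive to
`o(N)` off-line zeros (§1.4).

## References

* [AF26] as above [key `AlpogeFurman2026`]. Its references for the comparanda: Montgomery 1973
  [`Montgomery1973`], Bui–Heath-Brown 2013 [`BuiHeathbrown2013`], Titchmarsh–Heath-Brown 1986
  [`Titchmarsh1986`] (tree file `SimpleZeros.lean`); Conrey 1983 [`Conrey1983`] (`XiDerivativeZeros.lean`).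
-/

noncomputable section

open Complex Filter Set MeasureTheory
open scoped Real Topology ComplexOrder

namespace Literature.NumberTheory.LFunctions

/-! ## Theorem A for `ζ` (claims) -/

/-- **[AF26] Theorem A (i), dyadic form** (p. 1; repository `Zeta23.thmB₀_mult`, Appendix A p. 15:
`∀ ε > 0, ∃ T₀, ∀ T ≥ T₀, (2/3 − ε) · Ncount T (2T) ≤ N0simple T (2T)`): as `T → ∞`,
`N₀^s(T,2T) ≥ (2/3 − o(1)) N(T,2T)` — at least two thirds of the zeros with `T < γ ≤ 2T`, counted
with multiplicity, are simple and on the critical line. Here `N(T,2T) = N(2T) − N(T)`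
(`zetaZeroCount`) and `N₀^s(T,2T) = N₀^s(2T) − N₀^s(T)` (`simpleCriticalZeroCount`). UNCONDITIONAL as
printed (no RH). Typed as a CLAIM of an unrefereed source; since DISCHARGED for the tree's typed model —
`AlpogeFurman2026_simple_critical_dyadic_holds` (`CriticalLineTwoThirdsTheoremAProofs.lean`) — so users'
`(h : AlpogeFurman2026_simple_critical_dyadic)` are fed by it. [claim: AlpogeFurman2026, status: under-review] -/
def AlpogeFurman2026_simple_critical_dyadic : Prop :=
  ∀ ε : ℝ, 0 < ε → ∀ᶠ T : ℝ in atTop,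
    (2 / 3 - ε) * ((zetaZeroCount (2 * T) : ℝ) - zetaZeroCount T) ≤
      (simpleCriticalZeroCount (2 * T) : ℝ) - simpleCriticalZeroCount T

/-- **[AF26] Theorem A (ii), dyadic form** (p. 1; repository `Zeta23.thmC₀_mult`:
`(5/6 − ε) · Ncount T (2T) ≤ Ndist T (2T)`): as `T → ∞`, `N_d(T,2T) ≥ (5/6 − o(1)) N(T,2T)` — at least
five sixths of the zeros with `T < γ ≤ 2T` are distinct (`N_d = distinctZeroCount`). UNCONDITIONAL as
printed. Typed as a CLAIM; since DISCHARGED — `AlpogeFurman2026_distinct_dyadic_holds`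
(`CriticalLineTwoThirdsTheoremAProofs.lean`). [claim: AlpogeFurman2026, status: under-review] -/
def AlpogeFurman2026_distinct_dyadic : Prop :=
  ∀ ε : ℝ, 0 < ε → ∀ᶠ T : ℝ in atTop,
    (5 / 6 - ε) * ((zetaZeroCount (2 * T) : ℝ) - zetaZeroCount T) ≤
      (distinctZeroCount (2 * T) : ℝ) - distinctZeroCount T

/-- **[AF26] Theorem A (i), cumulative form** (p. 2: "The same holds for `(0,T)` in place of `(T,2T)`";
repository `Zeta23.thmB₀_mult_cumulative`: `(2/3 − ε) · Ncount 0 T ≤ N0simple 0 T`): for every `ε > 0`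
and all large `T`, `(2/3 − ε) N(T) ≤ N₀^s(T)`. This is VERBATIM the conclusion of the RH-conditional
named fact `Montgomery1973_simple_zeros` (Titchmarsh (14.34.3)) with the hypothesis `RiemannHypothesis`
removed (`Montgomery1973_simple_zeros_of_AlpogeFurman2026`). Typed as a CLAIM; since DISCHARGED —
`AlpogeFurman2026_simple_critical_holds` (`CriticalLineTwoThirdsTheoremAProofs.lean`).
[claim: AlpogeFurman2026, status: under-review] -/
def AlpogeFurman2026_simple_critical : Prop :=
  ∀ ε : ℝ, 0 < ε → ∀ᶠ T : ℝ in atTop,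
    (2 / 3 - ε) * (zetaZeroCount T : ℝ) ≤ simpleCriticalZeroCount T

/-- **[AF26] Theorem A (ii), cumulative form** (p. 2; repository `Zeta23.thmC₀_mult_cumulative`:
`(5/6 − ε) · Ncount 0 T ≤ Ndist 0 T`): for every `ε > 0` and all large `T`, `(5/6 − ε) N(T) ≤ N_d(T)` —
the conclusion of `Montgomery1973_distinct_zeros` without RH. Typed as a CLAIM; since DISCHARGED —
`AlpogeFurman2026_distinct_holds` (`CriticalLineTwoThirdsTheoremAProofs.lean`).
[claim: AlpogeFurman2026, status: under-review] -/
def AlpogeFurman2026_distinct : Prop :=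
  ∀ ε : ℝ, 0 < ε → ∀ᶠ T : ℝ in atTop,
    (5 / 6 - ε) * (zetaZeroCount T : ℝ) ≤ distinctZeroCount T

/-- The Montgomery–Taylor constant `c_MT⁻¹ := ½ + (1/√2) cot(1/√2) = 1.32749…` of [AF26] Theorem A
(p. 1) = `R(ψ_MT)` of Lemma 5.6; the same number is the Montgomery–Taylor/Cheer–Goldston constant of
`CheerGoldston1993_sum_multiplicity` (`SimpleZeros.lean`, rounded there to `1.3275`). The repository's
`cMT := √2 tan(1/√2)/(1 + (1/√2) tan(1/√2))` is its reciprocal. [cite: AlpogeFurman2026, Theorem A (p. 1) and Lemma 5.6 (p. 11)] -/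
def montgomeryTaylorInvConstant : ℝ :=
  1 / 2 + (1 / Real.sqrt 2) * Real.cot (1 / Real.sqrt 2)

/-- **[AF26] Theorem A, second sentence, simple zeros** (p. 1; repository
`montgomery_taylor_simple_on_critical_line_mult`: `(2 − 1/cMT − ε) · Ncount T (2T) ≤ N0simple T (2T)`):
with the Montgomery–Taylor window, `N₀^s(T,2T) ≥ (2 − c_MT⁻¹ − o(1)) N(T,2T)`, `2 − c_MT⁻¹ = 0.67250…`.
Typed as a CLAIM; since DISCHARGED — `AlpogeFurman2026_simple_critical_MT_dyadic_holds`
(`CriticalLineTwoThirdsTheoremAProofs.lean`). [claim: AlpogeFurman2026, status: under-review] -/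
def AlpogeFurman2026_simple_critical_MT_dyadic : Prop :=
  ∀ ε : ℝ, 0 < ε → ∀ᶠ T : ℝ in atTop,
    (2 - montgomeryTaylorInvConstant - ε) * ((zetaZeroCount (2 * T) : ℝ) - zetaZeroCount T) ≤
      (simpleCriticalZeroCount (2 * T) : ℝ) - simpleCriticalZeroCount T

/-- **[AF26] Theorem A, second sentence, distinct zeros** (p. 1; repository
`montgomery_taylor_distinct_mult`: `(3/2 − cMT⁻¹/2 − ε) · Ncount T (2T) ≤ Ndist T (2T)`): with the
Montgomery–Taylor window, `N_d(T,2T) ≥ (½(3 − c_MT⁻¹) − o(1)) N(T,2T)`, `½(3 − c_MT⁻¹) = 0.83625…`.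
Typed as a CLAIM; since DISCHARGED — `AlpogeFurman2026_distinct_MT_dyadic_holds`
(`CriticalLineTwoThirdsTheoremAProofs.lean`). [claim: AlpogeFurman2026, status: under-review] -/
def AlpogeFurman2026_distinct_MT_dyadic : Prop :=
  ∀ ε : ℝ, 0 < ε → ∀ᶠ T : ℝ in atTop,
    ((3 - montgomeryTaylorInvConstant) / 2 - ε) * ((zetaZeroCount (2 * T) : ℝ) - zetaZeroCount T) ≤
      (distinctZeroCount (2 * T) : ℝ) - distinctZeroCount T

/-- **[AF26] Remark 6.1 (rate), flat window** (p. 12: "Tracking errors gives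
`N₀^s(T,2T) ≥ (2 − R(ψ) − c_ψ log log T/log T) N(T,2T)` for `T ≥ T₀(ψ,χ)`"), at `ψ = ψ₀`,
`2 − R(ψ₀) = 2/3`: there are `c` and `T₀` with
`(2/3 − c · log log T / log T) N(T,2T) ≤ N₀^s(T,2T)` for all `T ≥ T₀`. Not among the repository's
reproduced statements. Typed as a CLAIM; since DISCHARGED — `AlpogeFurman2026_simple_critical_rate_holds`
(`CriticalLineTwoThirdsTheoremAProofs.lean`). [claim: AlpogeFurman2026, status: under-review] -/
def AlpogeFurman2026_simple_critical_rate : Prop :=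
  ∃ c T₀ : ℝ, ∀ T : ℝ, T₀ ≤ T →
    (2 / 3 - c * Real.log (Real.log T) / Real.log T) * ((zetaZeroCount (2 * T) : ℝ) - zetaZeroCount T) ≤
      (simpleCriticalZeroCount (2 * T) : ℝ) - simpleCriticalZeroCount T

/-! ## Cheap consequences (proved) -/

/-- "A fortiori `N₀ ≥ (2/3 − o(1)) N`" ([AF26] Theorem A, last sentence; cumulative form), PROVED from
the claim: `(2/3 − ε) N(T) ≤ N₀(T)` for all large `T` (`N₀ = criticalZeroCount`, with multiplicity).
[cite: AlpogeFurman2026, Theorem A (p. 1), last sentence] -/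
theorem AlpogeFurman2026_simple_critical.critical (h : AlpogeFurman2026_simple_critical) :
    ∀ ε : ℝ, 0 < ε → ∀ᶠ T : ℝ in atTop, (2 / 3 - ε) * (zetaZeroCount T : ℝ) ≤ criticalZeroCount T := by
  intro ε hε
  filter_upwards [h ε hε] with T hT
  exact hT.trans (by exact_mod_cast simpleCriticalZeroCount_le_criticalZeroCount T)

/-- "A fortiori `N^s ≥ (2/3 − o(1)) N`" ([AF26] Theorem A, last sentence; cumulative form), PROVED from
the claim: `(2/3 − ε) N(T) ≤ N^s(T)` for all large `T` (`N^s = simpleZeroCount`).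
[cite: AlpogeFurman2026, Theorem A (p. 1), last sentence] -/
theorem AlpogeFurman2026_simple_critical.simple (h : AlpogeFurman2026_simple_critical) :
    ∀ ε : ℝ, 0 < ε → ∀ᶠ T : ℝ in atTop, (2 / 3 - ε) * (zetaZeroCount T : ℝ) ≤ simpleZeroCount T := by
  intro ε hε
  filter_upwards [h ε hε] with T hT
  exact hT.trans (by exact_mod_cast GLSS2026.simpleCriticalZeroCount_le_simpleZeroCount T)

/-- The claim supersedes the unconditional third of Levinson–Heath-Brown–Selberg–Anderson
(`Anderson1983_levinson_simple.third`, Titchmarsh §10.29): from it, `N(T)/3 ≤ N₀^s(T)` for all large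
`T` (take `ε = 1/3`). [cite: AlpogeFurman2026, §1.3 (p. 2)] -/
theorem AlpogeFurman2026_simple_critical.third (h : AlpogeFurman2026_simple_critical) :
    ∃ T₀ : ℝ, ∀ T : ℝ, T₀ ≤ T → (zetaZeroCount T : ℝ) / 3 ≤ simpleCriticalZeroCount T := by
  obtain ⟨T₀, hT₀⟩ := Filter.eventually_atTop.1 (h (1 / 3) (by norm_num))
  exact ⟨T₀, fun T hT ↦ by have := hT₀ T hT; linarith⟩

/-- Montgomery's RH-conditional `(14.34.3)` (`Montgomery1973_simple_zeros`, `SimpleZeros.lean`) follows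
from the unconditional claim (the hypothesis `RiemannHypothesis` is not used). [cite: AlpogeFurman2026, §1.1 (p. 2)] -/
theorem Montgomery1973_simple_zeros_of_AlpogeFurman2026 (h : AlpogeFurman2026_simple_critical) :
    Montgomery1973_simple_zeros :=
  fun _ ↦ h

/-- Montgomery's RH-conditional `κ_d ≥ 5/6` (`Montgomery1973_distinct_zeros`, `SimpleZeros.lean`)
follows from the unconditional claim. [cite: AlpogeFurman2026, §1.1 (p. 2)] -/
theorem Montgomery1973_distinct_zeros_of_AlpogeFurman2026 (h : AlpogeFurman2026_distinct) :
    Montgomery1973_distinct_zeros :=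
  fun _ ↦ h

/-! ## Lemma 3.2: the rank–trace inequality (claim; elementary linear algebra) -/

/-- `n₊(A)`: the number of strictly positive eigenvalues of a Hermitian matrix `A` ([AF26] §1.7),
read off Mathlib's `Matrix.IsHermitian.eigenvalues`. (Mathlib has Sylvester's diagonalisation but no
named inertia index; this is the 1-line count.) [cite: AlpogeFurman2026, §1.7 (p. 3)] -/
def posEigenvalueCount {n : Type*} [Fintype n] [DecidableEq n] {A : Matrix n n ℂ}
    (hA : A.IsHermitian) : ℕ :=
  (Finset.univ.filter fun i ↦ 0 < hA.eigenvalues i).card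

/-- **[AF26] Lemma 3.2 (Rank–trace inequality)** (p. 5): for Hermitian `d × d` matrices `P ⪰ 0` and
`Q` with `rank P ≤ r` and `n₊(Q) ≤ b`, `r ≥ 2 tr P + 4 tr Q − 4b − ‖P + Q‖²_HS` (`‖R‖²_HS = tr R²`).
"Equality holds if `P = Π₁`, `Q = 2Π₂` for orthogonal projections `Π₁ ⊥ Π₂` of ranks `r, b`." Printed
proof via von Neumann's trace inequality (not in this tree's Mathlib); the scalar shadows
`m² ≥ 2m − 1`, `(m−1)(m−2) ≥ 0` are `two_mul_sum_sub_sum_sq_le_card_filter_eq_one` /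
`three_mul_sum_sub_sum_sq_le_two_mul_card` of `SimpleZeros.lean`. Over `ℂ`, traces through `re`.
CLAIM, not proved here. [claim: AlpogeFurman2026, status: under-review] -/
def AlpogeFurman2026_rank_trace : Prop :=
  ∀ (d : ℕ) (P Q : Matrix (Fin d) (Fin d) ℂ) (_hP : P.PosSemidef) (hQ : Q.IsHermitian) (r b : ℕ),
    P.rank ≤ r → posEigenvalueCount hQ ≤ b →
      2 * (P.trace).re + 4 * (Q.trace).re - 4 * (b : ℝ) - (((P + Q) * (P + Q)).trace).re ≤ (r : ℝ)

/-! ## Lemma 5.6: the window constant `R(ψ)` -/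

/-- The window constant (5.10) of [AF26] Lemma 5.6 (p. 11):
`R(ψ) = (∫_{−½}^{½} ψ² + ∫_{−½}^{½}∫_{−½}^{½} |u − v| ψ(u) ψ(v) dv du)/(∫_{−½}^{½} ψ)²`, for a window
`ψ` given by its values on `[−½,½]`. The certified proportions are `2 − R(ψ)` (simple, on the line) and
`½(3 − R(ψ))` (distinct). [cite: AlpogeFurman2026, Lemma 5.6 eq. (5.10) (p. 11)] -/
def windowConstant (ψ : ℝ → ℝ) : ℝ :=
  ((∫ u in (-(1 / 2 : ℝ))..(1 / 2), ψ u ^ 2) +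
      ∫ u in (-(1 / 2 : ℝ))..(1 / 2), ∫ v in (-(1 / 2 : ℝ))..(1 / 2), |u - v| * (ψ u * ψ v)) /
    (∫ u in (-(1 / 2 : ℝ))..(1 / 2), ψ u) ^ 2

/-- The Montgomery–Taylor window `ψ_MT(s) = cos(√2 s)` on `[−½,½]` ([AF26] (2.7), p. 4).
[cite: AlpogeFurman2026, eq. (2.7) (p. 4)] -/
def montgomeryTaylorWindow (s : ℝ) : ℝ :=
  Real.cos (Real.sqrt 2 * s)

/-- `∫_{−½}^{½} |u − v| dv = u² + ¼` for `u ∈ [−½,½]`. [folklore] -/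
private theorem integral_abs_sub (u : ℝ) (hu : u ∈ Icc (-(1 / 2 : ℝ)) (1 / 2)) :
    ∫ v in (-(1 / 2 : ℝ))..(1 / 2), |u - v| = u ^ 2 + 1 / 4 := by
  obtain ⟨hu1, hu2⟩ := hu
  have hint : ∀ a b : ℝ, IntervalIntegrable (fun v ↦ |u - v|) volume a b := fun a b ↦
    (continuous_const.sub continuous_id).abs.intervalIntegrable a b
  rw [← intervalIntegral.integral_add_adjacent_intervals (hint _ u) (hint u _)]
  have h1 : ∫ v in (-(1 / 2 : ℝ))..u, |u - v| = ∫ v in (-(1 / 2 : ℝ))..u, (u - v) :=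
    intervalIntegral.integral_congr fun v hv ↦ by
      rw [uIcc_of_le hu1] at hv
      exact abs_of_nonneg (by linarith [hv.2])
  have h2 : ∫ v in u..(1 / 2 : ℝ), |u - v| = ∫ v in u..(1 / 2 : ℝ), (v - u) :=
    intervalIntegral.integral_congr fun v hv ↦ by
      rw [uIcc_of_le hu2] at hv
      rw [abs_of_nonpos (by linarith [hv.1])]
      ring
  rw [h1, h2, intervalIntegral.integral_sub intervalIntegrable_const intervalIntegral.intervalIntegrable_id,
    intervalIntegral.integral_sub intervalIntegral.intervalIntegrable_id intervalIntegrable_const]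
  simp only [intervalIntegral.integral_const, integral_id, smul_eq_mul]
  ring

/-- **[AF26] Lemma 5.6, first value: `R(ψ₀) = 4/3`** for the flat window `ψ₀ = 1` on `[−½,½]`
(`∫ψ₀ = ∫ψ₀² = 1`, `∫∫|u − v| = 1/3`), PROVED. [cite: AlpogeFurman2026, Lemma 5.6 (p. 11)] -/
theorem windowConstant_one : windowConstant (fun _ ↦ 1) = 4 / 3 := by
  have hdouble : ∫ u in (-(1 / 2 : ℝ))..(1 / 2), ∫ v in (-(1 / 2 : ℝ))..(1 / 2),
      |u - v| * ((1 : ℝ) * 1) = 1 / 3 := by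
    have h1 : ∫ u in (-(1 / 2 : ℝ))..(1 / 2), ∫ v in (-(1 / 2 : ℝ))..(1 / 2), |u - v| * ((1 : ℝ) * 1) =
        ∫ u in (-(1 / 2 : ℝ))..(1 / 2), (u ^ 2 + 1 / 4) := by
      refine intervalIntegral.integral_congr fun u hu ↦ ?_
      rw [uIcc_of_le (by norm_num)] at hu
      simp only [mul_one]
      exact integral_abs_sub u hu
    rw [h1, intervalIntegral.integral_add (intervalIntegral.intervalIntegrable_pow 2)
      intervalIntegrable_const]
    simp only [integral_pow, intervalIntegral.integral_const, smul_eq_mul]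
    norm_num
  rw [windowConstant, hdouble]
  simp only [one_pow, intervalIntegral.integral_const, smul_eq_mul]
  norm_num

/-- The constants of Theorem A from `R(ψ₀) = 4/3` (chain (1.2)): `2 − R(ψ₀) = 2/3` and
`½(3 − R(ψ₀)) = 5/6`. [cite: AlpogeFurman2026, §1.2 eq. (1.2) (p. 2)] -/
theorem AlpogeFurman2026_constants :
    2 - windowConstant (fun _ ↦ 1) = 2 / 3 ∧ (3 - windowConstant (fun _ ↦ 1)) / 2 = 5 / 6 := by
  rw [windowConstant_one]; norm_num

/-- **[AF26] Lemma 5.6, second value** (p. 11): `R(ψ_MT) = ½ + (1/√2) cot(1/√2) = c_MT⁻¹` (proof in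
print: `G = ψ + ∫|u − v|ψ(v)dv` satisfies `G'' = ψ'' + 2ψ = 0`, hence is constant). CLAIM, not proved
here. [claim: AlpogeFurman2026, status: under-review] -/
def AlpogeFurman2026_windowConstant_MT : Prop :=
  windowConstant montgomeryTaylorWindow = montgomeryTaylorInvConstant

/-! ## Theorem B: primitive Dirichlet `L`-functions (claims) -/

namespace AlpogeFurman2026

variable {q : ℕ} [NeZero q]

/-- `N_χ(T₁,T₂)`: the non-trivial zeros `ρ` of `L(s,χ)` (`ExplicitPsiChar.charNontrivialZeros χ`:
`L(ρ,χ) = 0`, `0 < Re ρ < 1`) with `T₁ < Im ρ ≤ T₂`, counted with multiplicity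
`DirichletDisc.zeroOrder χ ρ` ([AF26] §1.1 with Theorem B's substitution `ζ ↦ L(s,χ)`).
[cite: AlpogeFurman2026, §1.1 (p. 1) and Theorem B (p. 2)] -/
def charWindowZeroCount (χ : DirichletCharacter ℂ q) (T₁ T₂ : ℝ) : ℕ :=
  ∑ᶠ ρ ∈ {ρ : ℂ | ρ ∈ ExplicitPsiChar.charNontrivialZeros χ ∧ T₁ < ρ.im ∧ ρ.im ≤ T₂},
    DirichletDisc.zeroOrder χ ρ

/-- `N^s_{0,χ}(T₁,T₂)`: the SIMPLE zeros of `L(s,χ)` on `Re ρ = ½` with `T₁ < Im ρ ≤ T₂`, each counted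
once. [cite: AlpogeFurman2026, §1.1 (p. 1) and Theorem B (p. 2)] -/
def charWindowSimpleCriticalZeroCount (χ : DirichletCharacter ℂ q) (T₁ T₂ : ℝ) : ℕ :=
  Set.ncard {ρ : ℂ | ρ ∈ ExplicitPsiChar.charNontrivialZeros χ ∧ T₁ < ρ.im ∧ ρ.im ≤ T₂ ∧
    ρ.re = 1 / 2 ∧ DirichletDisc.zeroOrder χ ρ = 1}

/-- `N_{d,χ}(T₁,T₂)`: the DISTINCT non-trivial zeros of `L(s,χ)` with `T₁ < Im ρ ≤ T₂`.
[cite: AlpogeFurman2026, §1.1 (p. 1) and Theorem B (p. 2)] -/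
def charWindowDistinctZeroCount (χ : DirichletCharacter ℂ q) (T₁ T₂ : ℝ) : ℕ :=
  Set.ncard {ρ : ℂ | ρ ∈ ExplicitPsiChar.charNontrivialZeros χ ∧ T₁ < ρ.im ∧ ρ.im ≤ T₂}

end AlpogeFurman2026

/-- **[AF26] Theorem B, part (i)** (p. 2: "Theorem A holds verbatim for `L(s,χ)` in place of `ζ(s)`,
for any fixed primitive Dirichlet character `χ`"): for `χ` primitive mod `q`, as `T → ∞`,
`N^s_{0,χ}(T,2T) ≥ (2/3 − o(1)) N_χ(T,2T)`. CLAIM, not proved here. [claim: AlpogeFurman2026, status: under-review] -/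
def AlpogeFurman2026_dirichlet_simple_critical_dyadic : Prop :=
  ∀ (q : ℕ) [NeZero q] (χ : DirichletCharacter ℂ q), χ.IsPrimitive →
    ∀ ε : ℝ, 0 < ε → ∀ᶠ T : ℝ in atTop,
      (2 / 3 - ε) * (AlpogeFurman2026.charWindowZeroCount χ T (2 * T) : ℝ) ≤
        AlpogeFurman2026.charWindowSimpleCriticalZeroCount χ T (2 * T)

/-- **[AF26] Theorem B, part (ii)** (p. 2): for `χ` primitive mod `q`, as `T → ∞`,
`N_{d,χ}(T,2T) ≥ (5/6 − o(1)) N_χ(T,2T)`. CLAIM, not proved here. [claim: AlpogeFurman2026, status: under-review] -/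
def AlpogeFurman2026_dirichlet_distinct_dyadic : Prop :=
  ∀ (q : ℕ) [NeZero q] (χ : DirichletCharacter ℂ q), χ.IsPrimitive →
    ∀ ε : ℝ, 0 < ε → ∀ᶠ T : ℝ in atTop,
      (5 / 6 - ε) * (AlpogeFurman2026.charWindowZeroCount χ T (2 * T) : ℝ) ≤
        AlpogeFurman2026.charWindowDistinctZeroCount χ T (2 * T)

/-! ## Remark 7.1: zeros of `ξ′` (claim) -/

/-- **[AF26] Remark 7.1 (zeros of `ξ′`), flat window** (p. 14): unconditionally
`liminf_{T→∞} N^s_{0,ξ′}(T,2T)/N_{ξ′}(T,2T) ≥ 0.85838`, where `N_{ξ′}(T₁,T₂)` counts the zeros of `ξ′`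
with `T₁ < γ₁ ≤ T₂` with multiplicity and `N^s_{0,ξ′}` the simple ones with `β₁ = ½` ("the
Farmer–Gonek–Lee RH-conditional constant with RH removed"; previously `79.874 %` unconditionally,
Conrey 1989; "formalised … as `Zeta23.XiPrime.xiDeriv_simple_on_line`"). Tree vocabulary:
`N_{ξ′}(T,2T) = xiDerivZeroCount 1 (2T) − xiDerivZeroCount 1 T`; the simple critical zeros in the
window are the points of `xiDerivZeroBox 1 (2T) ∖ xiDerivZeroBox 1 T` with `Re s = ½` and
`analyticOrderAt (deriv ξ) s = 1` (`iteratedDeriv 1 = deriv`). CLAIM, not proved here.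
[claim: AlpogeFurman2026, status: under-review] -/
def AlpogeFurman2026_xiDeriv_simple_critical_dyadic : Prop :=
  ∀ ε : ℝ, 0 < ε → ∀ᶠ T : ℝ in atTop,
    (0.85838 - ε) * ((xiDerivZeroCount 1 (2 * T) : ℝ) - xiDerivZeroCount 1 T) ≤
      (Set.ncard {s ∈ xiDerivZeroBox 1 (2 * T) \ xiDerivZeroBox 1 T |
        s.re = 1 / 2 ∧ analyticOrderAt (iteratedDeriv 1 riemannXi) s = 1} : ℝ)

end Literature.NumberTheory.LFunctions

end
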